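import Summits.QuantumFields.YangMills.Theorems.UnitScaleTiltProp7HcoSOfSigmaRows
import Summits.QuantumFields.YangMills.Theorems.UnitScaleTiltProp7SigmaE2EArith
import Summits.QuantumFields.YangMills.Theorems.UnitScaleTiltProp7SigmaRowsNorm
import HarnessLib

/-!
# Route `UnitScaleTilt`, crux K1 «MinimiserStabilityRegPr» (stmt-QuantumFields-19200) — ARCHITECTURE (A′) ON Σ, THE HALF-WAY DOOR: `hcoS` ⇐ THE FIVE ANALYTIC MEMBER ROWS IN THEIR
# DIMENSIONAL SHAPES {COERC `γ = B₀⁻¹` (N06), LANDAU, SLOT `(kK, kE)·c₀ℓ²`, QSMALL `(kQ, kQ′)·c₀·e·ℓ²`, JOINT `(C₁, C₂, dv)` + DIV-SLICE `(ζ, δ₁)`} with L-only coefficients —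
# the CHART row, the NORM row, `κ`, the `κ`-arithmetic, both windows and the radius `e₇(L, B₁′)` are DISCHARGED here (✓p689273, ✓`Prop7SigmaE2EArith`)

Cell `ym3-torus` ∕ fleet seat `ym-ust-19200-p1` (gen 17, route-R E′ lead ∕ namer).  THEOREMS ONLY (0 `def`, 0 `sorry`); `--supports stmt-QuantumFields-19200`, count-neutral.
YM₃ on T³ is a ladder rung (R3), not the Clay problem; nothing here claims the stub, the crux, `hcoS`, d = 4 or the mass gap — the five analytic rows are DISPLAYED (E2E-SIGMA-SPEC).

WHY (E2E-SIGMA-SPEC, WORD 19 (c)).  The junction door of record ✓`Prop7HcoSOfSigmaRows.hcoS_of_sigmaRowsS` (★★OWNER ACK 93) asks each member for thirteen reals and fifteen conjuncts; eight of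
them are bookkeeping once the analytic rows come in the shapes print's units force (`‖A‖² = ℓ⁻¹M`, `‖∇A‖² = ℓK`): `s := 2B₁′e·ℓ⁻¹` from (19) (`In19.norm_lt`), `cN := c₀` (✓`c0_mul_sum_norm_sq_le_
norm_sq_toL2`), `κ := (B₀⁻¹ − (kE + kQ′)e)∕((kK + kQ·e)ℓ²)` (✓`kappa_arith`, equality), the windows (✓`joint_window`, ✓`hess_window`, `regThreshold = e·ℓ⁻²`), `4s ≤ 1` (✓`chart_window`),
under ONE L-only radius `e₇ := min(e₀, 1, (2B₀(kE+kQ′+1))⁻¹, (16B₀(kK+kQ)(2(C₁+C₂δ₁)+62208B₁′²+217))⁻¹, (16C₂(1+ζ)+1)⁻¹, (8B₁′)⁻¹)`.  What remains displayed is exactly the suppliers'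
list: COERC (w4 ✓p691966 at N06 `norm_G₀ᶜ`), LANDAU (w1 `RcombL2_DstarL2_eq_zero_of_isLandauPrint`), SLOT (px5), QSMALL (✓p692319 ∘ ✓p692053 ∘ px6's `Qkc`), JOINT (routeR-w2 g8's
JOINT-Σ LEG door over the P-A2 binder) + DIV-SLICE (px12 ✓`div_sq_le_of_competitorRow` ∘ px19∕px11).

WHAT IS PROVED (ns `…Theorems.Prop7HcoSOfMemberRows`): ★★★ `hcoS_of_memberRowsS` — hypothesis `hRows` = per `(L, B₁′)` the L-only data `(e₀, B₀, kK, kE, kQ, kQ′, C₁, C₂, ζ, δ₁)` with signs and,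
for every Σ-datum of the `hcoS` binder at radius `e ≤ e₀`, the five rows above (slots `Rr`, `Qc`, `Δx`, weights `c₀`, `aQ` generic as in ✓p691484); CONCLUSION = `hcoS` VERBATIM.
HONEST SCOPE.  Composition + real arithmetic over landed theorems; every analytic row is DISPLAYED; nothing of print is asserted.

References: T. Bałaban, CMP 102 (1985) 277–309 [Balaban1985Variational] ((19) p.281, (106)–(111) p.294, (141)–(142) p.299); CMP 99 (1985) 389–434 [Balaban1985BackgroundPropagators]
(Thm 3.11 p.416, (3.10)–(3.12) p.392); CMP 99 (1985) 75–102 [Balaban1985RegularSpaces] ((1.38) p.82).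
-/

set_option autoImplicit false
noncomputable section

open scoped BigOperators Matrix.Norms.L2Operator Matrix Topology InnerProductSpace
open Filter NormedSpace

namespace Summit.QuantumFields.YangMills.Theorems.Prop7HcoSOfMemberRows

open Literature.MathematicalPhysics.QuantumFieldTheory.Balaban1983to89
open Literature.MathematicalPhysics.QuantumFieldTheory.Balaban1983to89.T3ContinuumYM3Torus
open Literature.MathematicalPhysics.QuantumFieldTheory.Balaban1983to89.T3UnitLawDensityEML (ℰp)
open Literature.MathematicalPhysics.QuantumFieldTheory.Balaban1983to89.T3ConstrainedMinimiser (fibre)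
open Literature.MathematicalPhysics.QuantumFieldTheory.Balaban1983to89.T3PrintedRegularMinimiser
open Literature.MathematicalPhysics.QuantumFieldTheory.Balaban1983to89.T3RegularMinimiser
open Literature.MathematicalPhysics.QuantumFieldTheory.Balaban1983to89.T3Thm1Carrier
open T4Continuum BlockAveraging AveragingRT ExpMeanLog BlockAveragingEMLLinearised BlockAveragingEMLLinearisedBackground BlockAveragingEMLProp2
open B10Eq27TorusAxialLog (pull)
open T3SectALandauChart (emb15 eta bgUnits)
open B11Eq103H1Complex (BondL2K)
open Summit.QuantumFields.YangMills.Theorems.Prop7SPrint (basePt RestrictedPrint IsLandauPrintS)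
open Summit.QuantumFields.YangMills.Theorems.Prop7SectET3Transport (periodsT3)
open Summit.QuantumFields.YangMills.Theorems.Prop7SectET3HilbertLetters (W₂ toL2)
open Summit.QuantumFields.YangMills.Theorems.Prop7SectET3CurvedPropagators (Qk laplaceA)
open Summit.QuantumFields.YangMills.Theorems.Prop7HcoWOfGaugedRows (hcoW_of_gaugedRowsW)
open Summit.QuantumFields.YangMills.Theorems.Prop7HessOnPrintSlice (hess_of_laplaceA_coercive_of_isLandauPrintS)
open Summit.QuantumFields.YangMills.Theorems.Prop7HcoWOfSigmaRows (hess_arith)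
open Summit.QuantumFields.YangMills.Theorems.Prop7SPrint (AvgCondPrint IsLandauPrint)
open Summit.QuantumFields.YangMills.Theorems.Prop7TPrint (expHermField)
open T3SectALandauChart (In19)
open Summit.QuantumFields.YangMills.Theorems.Prop7SigmaE2EArith (chart_window kappa_arith joint_window hess_window)
open Summit.QuantumFields.YangMills.Theorems.Prop7SigmaRowsNorm (c0_mul_sum_norm_sq_le_norm_sq_toL2)


section DoorSlots

variable (c₀ : ℕ → ℝ) [hc₀ : ∀ L : ℕ, Fact (0 < c₀ L)] (aQ : T3Family → ℕ → ℕ → ℝ)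
  (Δx : ∀ (F : T3Family) (K : ℕ), GaugeField (F.P K) 0 (Matrix.specialUnitaryGroup (Fin 2) ℂ) → (BondL2K ℂ 3 (periodsT3 F K) (c₀ F.L) W₂ →ₗ[ℂ] BondL2K ℂ 3 (periodsT3 F K) (c₀ F.L) W₂))
  (Rr : ∀ (F : T3Family) (n K : ℕ), GaugeField (F.P K) 0 (Matrix.specialUnitaryGroup (Fin 2) ℂ) → (B11Eq103H1Complex.SiteL2K ℂ 3 (periodsT3 F K) (c₀ F.L) W₂ →ₗ[ℂ] B11Eq103H1Complex.SiteL2K ℂ 3 (periodsT3 F K) (c₀ F.L) W₂))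
  {CW : ∀ (F : T3Family) (n K : ℕ), n ≤ K → Type} [hCW₁ : ∀ F n K (h : n ≤ K), NormedAddCommGroup (CW F n K h)] [hCW₂ : ∀ F n K (h : n ≤ K), InnerProductSpace ℂ (CW F n K h)]
  [hCW₃ : ∀ F n K (h : n ≤ K), FiniteDimensional ℂ (CW F n K h)]
  (Qc : ∀ (F : T3Family) (n K : ℕ) (h : n ≤ K), GaugeField (F.P K) 0 (Matrix.specialUnitaryGroup (Fin 2) ℂ) → (BondL2K ℂ 3 (periodsT3 F K) (c₀ F.L) W₂ →ₗ[ℂ] CW F n K h))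

set_option maxHeartbeats 400000 in
/-- ★★★ **`hcoS` ⇐ THE FIVE ANALYTIC MEMBER ROWS IN THEIR DIMENSIONAL SHAPES** (COERC `γ = B₀⁻¹`, LANDAU, SLOT `(kK·c₀ℓ², kE·c₀ℓ²)`, QSMALL `(kQ·c₀eℓ², kQ′·c₀eℓ²)`, JOINT `(C₁, C₂, dv)` +
DIV-SLICE `(ζ, δ₁)`, L-only data with signs, member radius `e₀`): the CHART and NORM rows, `κ`, the `κ`-arithmetic, both windows and the radius `e₇` of ✓`hcoS_of_sigmaRowsS` are
discharged; CONCLUSION = `hcoS` VERBATIM. [cite: Balaban1985Variational, (19) p.281, (106)-(111) p.294, (141)-(142) p.299; Balaban1985BackgroundPropagators, Thm 3.11 p.416, (3.10)-(3.12) p.392] -/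
theorem hcoS_of_memberRowsS
    (hRows : ∀ (L : ℕ), 1 < L → ∀ (B₁' : ℝ), 0 < B₁' → ∃ e₀ B₀ kK kE kQ kQ' C₁ C₂ ζ δ₁ : ℝ,
      0 < e₀ ∧ 0 < B₀ ∧ 0 < kK ∧ 0 ≤ kE ∧ 0 ≤ kQ ∧ 0 ≤ kQ' ∧ 0 ≤ C₁ ∧ 0 ≤ C₂ ∧ 0 ≤ ζ ∧ 0 ≤ δ₁ ∧
      ∀ (F : T3Family), F.L = L → ∀ (n K : ℕ) (hnK : n < K) (e : ℝ) (V : GaugeField (F.P n) 0 (Matrix.specialUnitaryGroup (Fin 2) ℂ))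
        (W : GaugeField (F.P K) 0 (Matrix.specialUnitaryGroup (Fin 2) ℂ)) (X : PBond (F.P K) 0 → Matrix (Fin 2) (Fin 2) ℂ),
        0 < e → e ≤ e₀ → W ∈ regFibrePr F n K hnK.le e V →
        (∀ γ : ℝ → GaugeField (F.P K) 0 (Matrix.specialUnitaryGroup (Fin 2) ℂ), γ 0 = W → (∀ t, γ t ∈ fibre F ℰp n K hnK.le V) →
          (∀ b, DifferentiableAt ℝ (fun t => ((γ t b : Matrix.specialUnitaryGroup (Fin 2) ℂ) : Matrix (Fin 2) (Fin 2) ℂ)) 0) →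
            deriv (fun t => wilsonAction4 (γ t)) 0 = 0) →
        In19 F n K (2 * B₁' * e) W (expHermField X) X → AvgCondPrint F n K hnK.le V W X → IsLandauPrint F n K W X →
            -- (COERC) from N06 `norm_G₀ᶜ` through ✓`coercive_slots_DeltaEta_of_normG₀`: `γ = B₀⁻¹`
            (∀ y : BondL2K ℂ 3 (periodsT3 F K) (c₀ F.L) W₂, B₀⁻¹ * ‖y‖ ^ 2 ≤ RCLike.re ⟪y, B11Eq103H1Complex.laplaceAK (Δx F K W) (Prop7SectET3HilbertLetters.DL2 F n K (c₀ F.L) W) (Rr F n K W) (Prop7SectET3HilbertLetters.DstarL2 F n K (c₀ F.L) W) (Qc F n K hnK.le W) (LinearMap.adjoint (Qc F n K hnK.le W)) (((aQ F n K : ℝ) : ℂ)) y⟫_ℂ) ∧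
            -- (LANDAU) the slice row at the projector slot of record
            Rr F n K W (Prop7SectET3HilbertLetters.DstarL2 F n K (c₀ F.L) W (toL2 F K (c₀ F.L) X)) = 0 ∧
            -- (SLOT) in the shape `cK = kK·c₀ℓ²`, `cE = kE·c₀ℓ²`
            RCLike.re ⟪toL2 F K (c₀ F.L) X, (Δx F K) W (toL2 F K (c₀ F.L) X)⟫_ℂ
              ≤ (kK * c₀ F.L * ((F.L : ℝ) ^ (K - n)) ^ 2) * (∑ p : Plaq (F.P K) 0, ‖((Complex.I • X ⟨p.src, p.μ⟩) + ((W ⟨p.src, p.μ⟩ : Matrix (Fin 2) (Fin 2) ℂ) * (Complex.I • X ⟨p.src.shift p.μ, p.ν⟩) * star (W ⟨p.src, p.μ⟩ : Matrix (Fin 2) (Fin 2) ℂ))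
            - (((W ⟨p.src, p.μ⟩ * W ⟨p.src.shift p.μ, p.ν⟩ * (W ⟨p.src.shift p.ν, p.μ⟩)⁻¹ : Matrix.specialUnitaryGroup (Fin 2) ℂ) : Matrix (Fin 2) (Fin 2) ℂ) * (Complex.I • X ⟨p.src.shift p.ν, p.μ⟩) * star ((W ⟨p.src, p.μ⟩ * W ⟨p.src.shift p.μ, p.ν⟩ * (W ⟨p.src.shift p.ν, p.μ⟩)⁻¹ : Matrix.specialUnitaryGroup (Fin 2) ℂ) : Matrix (Fin 2) (Fin 2) ℂ))
            - (((GaugeField.plaqHol W p : Matrix.specialUnitaryGroup (Fin 2) ℂ) : Matrix (Fin 2) (Fin 2) ℂ) * (Complex.I • X ⟨p.src, p.ν⟩) * star ((GaugeField.plaqHol W p : Matrix.specialUnitaryGroup (Fin 2) ℂ) : Matrix (Fin 2) (Fin 2) ℂ)))‖ ^ 2)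
                + (kE * c₀ F.L * ((F.L : ℝ) ^ (K - n)) ^ 2) * e * (((F.L : ℝ) ^ (K - n)) ^ 2)⁻¹ * (∑ b : PBond (F.P K) 0, ‖X b‖ ^ 2) ∧
            -- (QSMALL) in the shape `qK = kQ·c₀·e·ℓ²`, `qM = kQ′·c₀·e·ℓ²`
            aQ F n K * ‖Qc F n K hnK.le W (toL2 F K (c₀ F.L) X)‖ ^ 2
              ≤ (kQ * c₀ F.L * e * ((F.L : ℝ) ^ (K - n)) ^ 2) * (∑ p : Plaq (F.P K) 0, ‖((Complex.I • X ⟨p.src, p.μ⟩) + ((W ⟨p.src, p.μ⟩ : Matrix (Fin 2) (Fin 2) ℂ) * (Complex.I • X ⟨p.src.shift p.μ, p.ν⟩) * star (W ⟨p.src, p.μ⟩ : Matrix (Fin 2) (Fin 2) ℂ))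
            - (((W ⟨p.src, p.μ⟩ * W ⟨p.src.shift p.μ, p.ν⟩ * (W ⟨p.src.shift p.ν, p.μ⟩)⁻¹ : Matrix.specialUnitaryGroup (Fin 2) ℂ) : Matrix (Fin 2) (Fin 2) ℂ) * (Complex.I • X ⟨p.src.shift p.ν, p.μ⟩) * star ((W ⟨p.src, p.μ⟩ * W ⟨p.src.shift p.μ, p.ν⟩ * (W ⟨p.src.shift p.ν, p.μ⟩)⁻¹ : Matrix.specialUnitaryGroup (Fin 2) ℂ) : Matrix (Fin 2) (Fin 2) ℂ))
            - (((GaugeField.plaqHol W p : Matrix.specialUnitaryGroup (Fin 2) ℂ) : Matrix (Fin 2) (Fin 2) ℂ) * (Complex.I • X ⟨p.src, p.ν⟩) * star ((GaugeField.plaqHol W p : Matrix.specialUnitaryGroup (Fin 2) ℂ) : Matrix (Fin 2) (Fin 2) ℂ)))‖ ^ 2)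
                + (kQ' * c₀ F.L * e * ((F.L : ℝ) ^ (K - n)) ^ 2) * (((F.L : ℝ) ^ (K - n)) ^ 2)⁻¹ * (∑ b : PBond (F.P K) 0, ‖X b‖ ^ 2) ∧
            -- (JOINT in P-A2's currency + DIV-SLICE)
            ∃ dv : ℝ, (∀ (Q : (k : ℕ) → (PBond (F.P K) 0 → Matrix (Fin 2) (Fin 2) ℂ) → PBond (F.P K) k → Matrix (Fin 2) (Fin 2) ℂ), (∀ Y, Q 0 Y = Y) →
        (∀ (k : ℕ) (Y : PBond (F.P K) 0 → Matrix (Fin 2) (Fin 2) ℂ) (c : PBond (F.P K) (k + 1)), Q (k + 1) Y c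
          = fderiv ℂ (eml : (Idx (F.P K) → Matrix (Fin 2) (Fin 2) ℂ) → Matrix (Fin 2) (Fin 2) ℂ)
              (fun i => ((loopHol (Averaging.iter (fun i => blockAvg (P := F.P K) (j := i) (expMeanLogSU (n := Fin 2))) k W) c i :
                Matrix.specialUnitaryGroup (Fin 2) ℂ) : Matrix (Fin 2) (Fin 2) ℂ))
              (fun i => covWalkSum (Averaging.iter (fun i => blockAvg (P := F.P K) (j := i) (expMeanLogSU (n := Fin 2))) k W) (Q k Y)
                  (walk (emb c.src) (loopWord (F.P K).L c.dir (off i.1) i.2.1 i.2.2))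
                * ((loopHol (Averaging.iter (fun i => blockAvg (P := F.P K) (j := i) (expMeanLogSU (n := Fin 2))) k W) c i :
                  Matrix.specialUnitaryGroup (Fin 2) ℂ) : Matrix (Fin 2) (Fin 2) ℂ))
              * star ((corr (expMeanLogSU (n := Fin 2)) (Averaging.iter (fun i => blockAvg (P := F.P K) (j := i) (expMeanLogSU (n := Fin 2))) k W) c :
                  Matrix.specialUnitaryGroup (Fin 2) ℂ) : Matrix (Fin 2) (Fin 2) ℂ)
            + ((corr (expMeanLogSU (n := Fin 2)) (Averaging.iter (fun i => blockAvg (P := F.P K) (j := i) (expMeanLogSU (n := Fin 2))) k W) c :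
                  Matrix.specialUnitaryGroup (Fin 2) ℂ) : Matrix (Fin 2) (Fin 2) ℂ)
              * covWalkSum (Averaging.iter (fun i => blockAvg (P := F.P K) (j := i) (expMeanLogSU (n := Fin 2))) k W) (Q k Y)
                  (walk (emb c.src) (List.replicate (F.P K).L (c.dir, true)))
              * star ((corr (expMeanLogSU (n := Fin 2)) (Averaging.iter (fun i => blockAvg (P := F.P K) (j := i) (expMeanLogSU (n := Fin 2))) k W) c :
                  Matrix.specialUnitaryGroup (Fin 2) ℂ) : Matrix (Fin 2) (Fin 2) ℂ)) →
            ∃ μ : Site (F.P K) (K - n) → Matrix (Fin 2) (Fin 2) ℂ, (∀ y, μ y ∈ skewAdjoint (Matrix (Fin 2) (Fin 2) ℂ) ∧ (μ y).trace = 0) ∧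
            ∑ c : PBond (F.P K) (K - n), ‖Q (K - n) (fun b => Complex.I • X b) c
                - (μ c.src
                  - ((Averaging.iter (fun i => blockAvg (P := F.P K) (j := i) (expMeanLogSU (n := Fin 2))) (K - n) W c : Matrix.specialUnitaryGroup (Fin 2) ℂ) :
                      Matrix (Fin 2) (Fin 2) ℂ) * μ c.tgt
                    * star ((Averaging.iter (fun i => blockAvg (P := F.P K) (j := i) (expMeanLogSU (n := Fin 2))) (K - n) W c : Matrix.specialUnitaryGroup (Fin 2) ℂ) :
                      Matrix (Fin 2) (Fin 2) ℂ))‖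
              ≤ C₁ * ((F.L : ℝ) ^ (K - n))⁻¹ * (∑ b : PBond (F.P K) 0, ‖X b‖ ^ 2)
                + C₂ * (F.L : ℝ) ^ (K - n) * (∑ p : Plaq (F.P K) 0, ‖((Complex.I • X ⟨p.src, p.μ⟩) + ((W ⟨p.src, p.μ⟩ : Matrix (Fin 2) (Fin 2) ℂ) * (Complex.I • X ⟨p.src.shift p.μ, p.ν⟩) * star (W ⟨p.src, p.μ⟩ : Matrix (Fin 2) (Fin 2) ℂ))
            - (((W ⟨p.src, p.μ⟩ * W ⟨p.src.shift p.μ, p.ν⟩ * (W ⟨p.src.shift p.ν, p.μ⟩)⁻¹ : Matrix.specialUnitaryGroup (Fin 2) ℂ) : Matrix (Fin 2) (Fin 2) ℂ) * (Complex.I • X ⟨p.src.shift p.ν, p.μ⟩) * star ((W ⟨p.src, p.μ⟩ * W ⟨p.src.shift p.μ, p.ν⟩ * (W ⟨p.src.shift p.ν, p.μ⟩)⁻¹ : Matrix.specialUnitaryGroup (Fin 2) ℂ) : Matrix (Fin 2) (Fin 2) ℂ))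
            - (((GaugeField.plaqHol W p : Matrix.specialUnitaryGroup (Fin 2) ℂ) : Matrix (Fin 2) (Fin 2) ℂ) * (Complex.I • X ⟨p.src, p.ν⟩) * star ((GaugeField.plaqHol W p : Matrix.specialUnitaryGroup (Fin 2) ℂ) : Matrix (Fin 2) (Fin 2) ℂ)))‖ ^ 2 + dv)) ∧
              dv ≤ ζ * (∑ p : Plaq (F.P K) 0, ‖((Complex.I • X ⟨p.src, p.μ⟩) + ((W ⟨p.src, p.μ⟩ : Matrix (Fin 2) (Fin 2) ℂ) * (Complex.I • X ⟨p.src.shift p.μ, p.ν⟩) * star (W ⟨p.src, p.μ⟩ : Matrix (Fin 2) (Fin 2) ℂ))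
            - (((W ⟨p.src, p.μ⟩ * W ⟨p.src.shift p.μ, p.ν⟩ * (W ⟨p.src.shift p.ν, p.μ⟩)⁻¹ : Matrix.specialUnitaryGroup (Fin 2) ℂ) : Matrix (Fin 2) (Fin 2) ℂ) * (Complex.I • X ⟨p.src.shift p.ν, p.μ⟩) * star ((W ⟨p.src, p.μ⟩ * W ⟨p.src.shift p.μ, p.ν⟩ * (W ⟨p.src.shift p.ν, p.μ⟩)⁻¹ : Matrix.specialUnitaryGroup (Fin 2) ℂ) : Matrix (Fin 2) (Fin 2) ℂ))
            - (((GaugeField.plaqHol W p : Matrix.specialUnitaryGroup (Fin 2) ℂ) : Matrix (Fin 2) (Fin 2) ℂ) * (Complex.I • X ⟨p.src, p.ν⟩) * star ((GaugeField.plaqHol W p : Matrix.specialUnitaryGroup (Fin 2) ℂ) : Matrix (Fin 2) (Fin 2) ℂ)))‖ ^ 2)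
                + δ₁ * (((F.L : ℝ) ^ (K - n)) ^ 2)⁻¹ * (∑ b : PBond (F.P K) 0, ‖X b‖ ^ 2))
    :
    ∀ (L : ℕ), 1 < L → ∀ (B₁' : ℝ), 0 < B₁' → ∃ e₇ : ℝ, 0 < e₇ ∧
      ∀ (F : T3Family), F.L = L → ∀ (n K : ℕ) (hnK : n < K) (e : ℝ) (V : GaugeField (F.P n) 0 (Matrix.specialUnitaryGroup (Fin 2) ℂ))
        (W : GaugeField (F.P K) 0 (Matrix.specialUnitaryGroup (Fin 2) ℂ)) (X : PBond (F.P K) 0 → Matrix (Fin 2) (Fin 2) ℂ),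
        0 < e → e ≤ e₇ → W ∈ regFibrePr F n K hnK.le e V →
        (∀ γ : ℝ → GaugeField (F.P K) 0 (Matrix.specialUnitaryGroup (Fin 2) ℂ), γ 0 = W → (∀ t, γ t ∈ fibre F ℰp n K hnK.le V) →
          (∀ b, DifferentiableAt ℝ (fun t => ((γ t b : Matrix.specialUnitaryGroup (Fin 2) ℂ) : Matrix (Fin 2) (Fin 2) ℂ)) 0) →
            deriv (fun t => wilsonAction4 (γ t)) 0 = 0) →
        In19 F n K (2 * B₁' * e) W (expHermField X) X → AvgCondPrint F n K hnK.le V W X → IsLandauPrint F n K W X →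
          wilsonAction4 W ≤ wilsonAction4 (emb15 W (expHermField X)) := by
  refine Prop7HcoSOfSigmaRows.hcoS_of_sigmaRowsS c₀ aQ Δx Rr Qc ?_
  intro L hL B₁' hB₁'
  obtain ⟨e₀, B₀, kK, kE, kQ, kQ', C₁, C₂, ζ, δ₁, he₀, hB₀, hkK, hkE, hkQ, hkQ', hC₁, hC₂, hζ, hδ₁, H⟩ := hRows L hL B₁' hB₁'
  -- the L-only radius
  have hc2 : 0 < 2 * B₀ * (kE + kQ' + 1) := by positivity
  have hc3 : 0 < 16 * B₀ * (kK + kQ) * (2 * (C₁ + C₂ * δ₁) + 62208 * B₁' ^ 2 + 217) := by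
    have : 0 < kK + kQ := by linarith
    positivity
  have hc4 : 0 < 16 * (C₂ * (1 + ζ)) + 1 := by positivity
  have hc6 : 0 < 8 * B₁' := by positivity
  refine ⟨min e₀ (min 1 (min (2 * B₀ * (kE + kQ' + 1))⁻¹ (min (16 * B₀ * (kK + kQ) * (2 * (C₁ + C₂ * δ₁) + 62208 * B₁' ^ 2 + 217))⁻¹
      (min (16 * (C₂ * (1 + ζ)) + 1)⁻¹ (8 * B₁')⁻¹)))), ?_, ?_⟩
  · exact lt_min he₀ (lt_min one_pos (lt_min (inv_pos.mpr hc2) (lt_min (inv_pos.mpr hc3) (lt_min (inv_pos.mpr hc4) (inv_pos.mpr hc6)))))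
  intro F hF n K hnK e V W X he heε hWreg hEL h19 h20 h21
  -- unpack the radius
  have he₀' : e ≤ e₀ := heε.trans (min_le_left _ _)
  have hr1 := heε.trans (min_le_right _ _)
  have h1 : e ≤ 1 := hr1.trans (min_le_left _ _)
  have hr2 := hr1.trans (min_le_right _ _)
  have hr3 := hr2.trans (min_le_right _ _)
  have hr4 := hr3.trans (min_le_right _ _)
  have hmul : ∀ {c : ℝ}, 0 < c → e ≤ c⁻¹ → c * e ≤ 1 := fun {c} hc hle =>
    calc c * e ≤ c * c⁻¹ := mul_le_mul_of_nonneg_left hle hc.le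
      _ = 1 := mul_inv_cancel₀ hc.ne'
  have h2 : 2 * B₀ * (kE + kQ' + 1) * e ≤ 1 := hmul hc2 (hr2.trans (min_le_left _ _))
  have h3 : 16 * B₀ * (kK + kQ) * (2 * (C₁ + C₂ * δ₁) + 62208 * B₁' ^ 2 + 217) * e ≤ 1 := hmul hc3 (hr3.trans (min_le_left _ _))
  have h4 : (16 * (C₂ * (1 + ζ)) + 1) * e ≤ 1 := hmul hc4 (hr4.trans (min_le_left _ _))
  have h6 : 8 * B₁' * e ≤ 1 := hmul hc6 (hr4.trans (min_le_right _ _))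
  -- the member's rows
  obtain ⟨hco, hLan, hSl, hQs, dv, hJ, hdv⟩ := H F hF n K hnK e V W X he he₀' hWreg hEL h19 h20 h21
  -- letters of the member
  have hL1 : (1 : ℝ) < (F.L : ℝ) := by rw [hF]; exact_mod_cast hL
  have hℓpos : (0 : ℝ) < (F.L : ℝ) ^ (K - n) := by positivity
  have hℓ1 : (1 : ℝ) ≤ (F.L : ℝ) ^ (K - n) := one_le_pow₀ hL1.le
  have hc₀ : (0 : ℝ) < c₀ F.L := (hc₀ F.L).out
  have hrT : regThreshold F n K e = e * (((F.L : ℝ) ^ (K - n)) ^ 2)⁻¹ := by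
    show e * ((F.L : ℝ)⁻¹) ^ (2 * (K - n)) = _
    rw [inv_pow, mul_comm 2 (K - n), pow_mul]
  obtain ⟨hposK, hκ⟩ := kappa_arith (B₀ := B₀) (kE := kE) (kQ' := kQ') hkK hkQ hc₀ he hℓpos
  refine ⟨2 * B₁' * e * ((F.L : ℝ) ^ (K - n))⁻¹, B₀⁻¹, c₀ F.L, kK * c₀ F.L * ((F.L : ℝ) ^ (K - n)) ^ 2, kE * c₀ F.L * ((F.L : ℝ) ^ (K - n)) ^ 2,
    kQ * c₀ F.L * e * ((F.L : ℝ) ^ (K - n)) ^ 2, kQ' * c₀ F.L * e * ((F.L : ℝ) ^ (K - n)) ^ 2, C₁, C₂,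
    (B₀⁻¹ - (kE + kQ') * e) / ((kK + kQ * e) * ((F.L : ℝ) ^ (K - n)) ^ 2), ζ, δ₁, dv,
    ?_, chart_window hB₁' he hℓ1 h6, hco, (inv_pos.mpr hB₀).le, hLan, c0_mul_sum_norm_sq_le_norm_sq_toL2 F K (c₀ F.L) X, hSl, hQs, hposK, hκ, hJ, hC₂, hdv,
    joint_window he h4, ?_⟩
  · -- CHART from (19)
    intro b
    have hb := (In19.norm_lt h19 b).le
    rw [inv_pow] at hb
    exact hb
  · -- the HESS window
    rw [hrT]
    exact hess_window hB₀ hkK hkQ hC₁ hC₂ hδ₁ hB₁' he hℓpos h1 h2 h3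

end DoorSlots

end Summit.QuantumFields.YangMills.Theorems.Prop7HcoSOfMemberRows

end
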